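import Summits.QuantumFields.BalabanUV.Beta.GAN24.AliasWeightsSum
import Summits.QuantumFields.BalabanUV.Beta.GAN24.SymbolTaylor

/-!
# `BalabanUV.Beta.GAN24.CapacitanceScalarBounds` — binder row G-an2-4 / (CONV-C), road P1-fibre: TWO-SIDED `N`-UNIFORM BOUNDS
# for the SCALAR ALIAS SUMS `a_κ(p)`, `σ(p)`, `h(p)` of the capacitance matrix at real momentum (nodes N09/N10 of SKELETON-P1)

NOT IN PRINT; OUR PROOF ATTEMPT.  HONEST FRAMING (cell contract, verbatim): «discharging `BetaPertH` makes Bałaban's UV stability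
UNCONDITIONAL — a real constructive-QFT result; it is NOT the continuum limit and NOT the Clay problem.»  HONEST DEPENDENCY (verbatim):
«continuum YM on T⁴ ⇐ BetaPertH ∧ nine spine estimates (0/9 proved); BetaPertH ⇐ (D1) ∧ (D4) ∧ CAP+tail; G-an2-4 gates asym, D1 and
NE2/3/4.»  [folklore] explicit analysis (King 1986 Lemma 4.1 pattern: LOWER bounds from the zero alias alone by Jordan's inequality,
UPPER bounds from the uniform alias-sum bound of leaf P1-L06); it discharges NOTHING of (CONV-C)'s K-slot `GAN24.CombesThomas.ConvCK 3 Lc`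
by itself.  NOT `BetaPertH`, NOT continuum, NOT Clay.  No `def … : Prop`, no cited fact, no wall binder; «not in print; our proof attempt».

## The objects (SKELETON-P1 S1b′ / A4′; the closed form of `GAN24/CapacitanceClosedForm`)
In the closed form `Cap = [[diag(a) − (σ/2)δδ♭ᵀ, σδ],[σδ♭ᵀ, 0]]` of the `(D+1)×(D+1)` capacitance matrix (journal l.2649/l.2733), the
`D + 2` scalars are alias sums over `m ∈ (ℤ/N)^D` of the block-average weights.  At REAL Brillouin momentum `p ∈ [−π, π]^D` and in
the currency of leaf P1-L06 (`AliasWeights.kfine`, `sinWt`; `AliasWeightsSum.lapR`, `aliasWtTerm`, `aliasWtConst`) they read, with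
`G(x, N) = Σ_{t<N} e^{ixt}`, `k_m = kfine N p m`, `L_m = lapR k_m = Σ_i 4 sin²(k_{m,i}/2)`:
* `gNormSq N x = ‖G(x, N)‖²` (so `|S(m)|² = Π_i gNormSq N k_{m,i}`, `|s_κ(m)|² = gNormSq N k_{m,κ}`);
* `blockWt N p m = |S(m)|²/N^D` (= `w_m = S(m)χ̂(m)` at real `p`);
* `capDiag N p κ = a_κ(p) = Σ_m w_m·|s_κ(m)|²/(2L_m)` (= `Σ_m wQ_{mκ} wE_{mκ}/(2L_m)`),
  `capBorder N p = σ(p) = Σ_m w_m/L_m²` (= `Σ_m wM_m wG_m/L_m²`), `capH N p = h(p) = Σ_κ 4 sin²(p_κ/2)/a_κ(p)` (= `Σ_κ δ_κδ♭_κ/a_κ`).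
The dictionary «concrete weights of rows L04c/L05(b)/T00 at `FibreDFT.kFine` ↦ these real sums» is NOT asserted here (one lemma for the
assembler once the weights are fixed: `wQ·wE = |S|²|s_κ|²/N^D` at real `p`, `AliasWeightsSum.lapSym_ofReal`).

## What is proved (every `D`, every `N ≥ 1`, every `p ∈ [−π, π]^D` with `p ≠ 0`, `|p|² = momSq p`; constants explicit and symbolic in `D`)
* §1 `gNormSq_eq_sin_sq_div` (`‖G(x,N)‖² = sin²(Nx/2)/sin²(x/2)`), `gNormSq_le_sq_mul_sinWt`/`gNormSq_le_sq` (L06 by name), and the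
  ZERO-ALIAS LOWER BOUND `sq_le_gNormSq_zero`: `(4/π²)·N² ≤ ‖G(p/N, N)‖²` for `|p| ≤ π` (Jordan + `sin² y ≤ y²`);
* §2 `blockWt_le` (`w_m ≤ N^D·Π_i sinWt`), `pow_le_blockWt_zero` (`(4/π²)^D N^D ≤ w_0`), `sq_mul_lapR_zero_le`/`le_sq_mul_lapR_zero`
  (`(4/π²)|p|² ≤ N²L_0 ≤ |p|²`, L07 by name);
* §3 **`capDiag_ge`**: `(4/π²)^{D+1}·N^{D+4}/(2|p|²) ≤ a_κ(p)`;  **`capDiag_le`**: `a_κ(p) ≤ N^{D+4}·(π²/(8|p|²) + aliasWtConst D/2)`;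
  positivity `capDiag_pos` and the inverse bound `inv_capDiag_le` (the hypothesis `‖a_κ⁻¹‖ ≤ α` of `CapacitanceClosedForm` §6, with an
  `N`-free constant × the `p`-scaling).
* §4–§5 (`σ`, `h`: `capBorder_ge/le/pos`, `inv_capBorder_le`, `capH_ge/le/pos`, `inv_capH_le`) are in the companion module
  `GAN24/CapacitanceScalarBoundsBorder` (same leaf, split for the 400-line limit).
These are A4′(i)/(ii)'s normalised limits `a_κ|p|²/N^{D+4} → 1/2`, `σ|p|⁴/N^{D+4} → 1` turned into `N`-UNIFORM two-sided bounds on the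
whole punctured zone; no cancellation is used.

Unit `b2b-balaban-gan24-formalise-leaf-12` (G-an2-4 formalisation swarm, leaf prover 12), 2026-08-19.  Value = kernel estimate leaf toward
the K-slot route P1, NOT summit progress.
-/

noncomputable section

open Complex Finset
open scoped BigOperators Real

namespace Summit.QuantumFields.BalabanUV.Beta.GAN24.CapacitanceScalarBounds

open AliasWeights AliasWeightsSum
open Literature.MathematicalPhysics.QuantumFieldTheory.King1986 (momSq momSq_nonneg)

variable {D : ℕ}

/-! ## §1  The squared geometric sum and its zero-alias lower bound -/

/-- `gNormSq N x = ‖Σ_{t<N} e^{ixt}‖²` — the squared modulus of the block geometric sum (`|s_κ(m)|²` at `x = k_{m,κ}`). -/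
def gNormSq (N : ℕ) (x : ℝ) : ℝ := ‖∑ t ∈ Finset.range N, cexp (I * x * t)‖ ^ 2

/-- [folklore] `0 ≤ gNormSq N x`. -/
theorem gNormSq_nonneg (N : ℕ) (x : ℝ) : 0 ≤ gNormSq N x := sq_nonneg _

/-- [folklore] `gNormSq N x ≤ N²·sinWt N x` (leaf P1-L06 `norm_geomExp_sq_le` by name). -/
theorem gNormSq_le_sq_mul_sinWt (N : ℕ) (x : ℝ) : gNormSq N x ≤ (N : ℝ) ^ 2 * sinWt N x :=
  norm_geomExp_sq_le x N

/-- [folklore] `gNormSq N x ≤ N²`. -/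
theorem gNormSq_le_sq (N : ℕ) (x : ℝ) : gNormSq N x ≤ (N : ℝ) ^ 2 :=
  (gNormSq_le_sq_mul_sinWt N x).trans (mul_le_of_le_one_right (sq_nonneg _) (sinWt_le_one N x))

/-- [folklore] CLOSED FORM `‖G(x, N)‖² = sin²(Nx/2)/sin²(x/2)` off the zero class (`sin(x/2) ≠ 0`), from
`G·(e^{ix} − 1) = e^{ixN} − 1` and `‖e^{iy} − 1‖ = 2|sin(y/2)|`. -/
theorem gNormSq_eq_sin_sq_div (N : ℕ) {x : ℝ} (hx : Real.sin (x / 2) ≠ 0) :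
    gNormSq N x = Real.sin (N * x / 2) ^ 2 / Real.sin (x / 2) ^ 2 := by
  have hid := geomExp_mul_sub_one (x : ℂ) N
  have h1 : ‖cexp (I * x) - 1‖ = 2 * |Real.sin (x / 2)| := by
    rw [Complex.norm_exp_I_mul_ofReal_sub_one, Real.norm_eq_abs, abs_mul, abs_two]
  have h2 : ‖cexp (I * x * N) - 1‖ = 2 * |Real.sin (N * x / 2)| := by
    rw [show I * (x : ℂ) * (N : ℂ) = I * ((N * x : ℝ) : ℂ) by push_cast; ring,
      Complex.norm_exp_I_mul_ofReal_sub_one, Real.norm_eq_abs, abs_mul, abs_two]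
  have hnorm : ‖∑ t ∈ Finset.range N, cexp (I * x * t)‖ * (2 * |Real.sin (x / 2)|) = 2 * |Real.sin (N * x / 2)| := by
    rw [← h1, ← norm_mul, hid, h2]
  have hs : 0 < |Real.sin (x / 2)| := abs_pos.2 hx
  have hG : ‖∑ t ∈ Finset.range N, cexp (I * x * t)‖ = |Real.sin (N * x / 2)| / |Real.sin (x / 2)| := by
    rw [eq_div_iff hs.ne']
    linarith
  unfold gNormSq
  rw [hG, div_pow, sq_abs, sq_abs]

/-- [folklore] `4/π² ≤ 1`. -/
theorem four_div_pi_sq_le_one : 4 / π ^ 2 ≤ (1 : ℝ) := by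
  rw [div_le_one (by positivity)]
  nlinarith [Real.pi_gt_three]

/-- **ZERO-ALIAS LOWER BOUND** [folklore; King 1986 Lemma 4.1 mechanism]: for `|p| ≤ π` and `N ≥ 1`,
`(4/π²)·N² ≤ ‖G(p/N, N)‖² = sin²(p/2)/sin²(p/(2N))` (Jordan `sin²(p/2) ≥ p²/π²` above, `sin²(p/(2N)) ≤ p²/(4N²)` below;
at `p = 0` the sum is `N`). -/
theorem sq_le_gNormSq_zero {N : ℕ} (hN : 1 ≤ N) {p : ℝ} (hp : |p| ≤ π) :
    4 / π ^ 2 * (N : ℝ) ^ 2 ≤ gNormSq N (p / N) := by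
  have hN0 : (0 : ℝ) < N := by exact_mod_cast hN
  by_cases hp0 : p = 0
  · subst hp0
    have hsum : ∑ t ∈ Finset.range N, cexp (I * (((0 : ℝ) / N : ℝ) : ℂ) * t) = N := by simp
    unfold gNormSq
    rw [hsum, Complex.norm_natCast]
    exact (mul_le_mul_of_nonneg_right four_div_pi_sq_le_one (sq_nonneg _)).trans_eq (one_mul _)
  · -- p ≠ 0: closed form and the two one-sided sine bounds
    have hpπ := Real.pi_pos
    have hy : p / N / 2 = p / (2 * N) := by ring
    have hybound : |p / (2 * N)| < π := by
      rw [abs_div, abs_of_pos (by positivity : (0 : ℝ) < 2 * N), div_lt_iff₀ (by positivity)]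
      have h1 : (1 : ℝ) ≤ N := by exact_mod_cast hN
      nlinarith [abs_nonneg p, Real.pi_pos]
    have hsin0 : Real.sin (p / N / 2) ≠ 0 := by
      rw [hy]
      intro h0
      rw [Real.sin_eq_zero_iff_of_lt_of_lt (by linarith [(abs_lt.1 hybound).1]) (abs_lt.1 hybound).2] at h0
      exact hp0 (by field_simp at h0; linarith [h0])
    rw [gNormSq_eq_sin_sq_div N hsin0, show (N : ℝ) * (p / N) / 2 = p / 2 by field_simp, hy]
    have hden_pos : 0 < Real.sin (p / (2 * N)) ^ 2 := by
      rw [← hy]; positivity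
    rw [le_div_iff₀ hden_pos]
    have hup : Real.sin (p / (2 * N)) ^ 2 ≤ (p / (2 * N)) ^ 2 := Real.sin_sq_le_sq
    have hlow : 4 / π ^ 2 * p ^ 2 ≤ 4 * Real.sin (p / 2) ^ 2 := SymbolTaylor.jordan_four_sin_sq_half hp
    calc 4 / π ^ 2 * (N : ℝ) ^ 2 * Real.sin (p / (2 * N)) ^ 2
        ≤ 4 / π ^ 2 * (N : ℝ) ^ 2 * (p / (2 * N)) ^ 2 := mul_le_mul_of_nonneg_left hup (by positivity)
      _ = (4 / π ^ 2 * p ^ 2) / 4 := by field_simp; ring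
      _ ≤ Real.sin (p / 2) ^ 2 := by linarith

/-! ## §2  Block weights, the zero alias and the Laplacian symbol at the zero alias -/

/-- The BLOCK WEIGHT `w_m = |S(m)|²/N^D = (Π_i ‖G(k_{m,i}, N)‖²)/N^D` (`= S(m)χ̂(m)` at real `p`). -/
def blockWt (N : ℕ) (p : Fin D → ℝ) (m : Fin D → ZMod N) : ℝ := (∏ i, gNormSq N (kfine N p m i)) / (N : ℝ) ^ D

/-- [folklore] `0 ≤ blockWt N p m`. -/
theorem blockWt_nonneg (N : ℕ) (p : Fin D → ℝ) (m : Fin D → ZMod N) : 0 ≤ blockWt N p m :=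
  div_nonneg (Finset.prod_nonneg fun _ _ => gNormSq_nonneg _ _) (pow_nonneg (Nat.cast_nonneg N) D)

/-- [folklore] UPPER weight bound `w_m ≤ N^D · Π_i sinWt N k_{m,i}` (`N ≥ 1`). -/
theorem blockWt_le {N : ℕ} (hN : 1 ≤ N) (p : Fin D → ℝ) (m : Fin D → ZMod N) :
    blockWt N p m ≤ (N : ℝ) ^ D * ∏ i, sinWt N (kfine N p m i) := by
  have hN0 : (0 : ℝ) < N := by exact_mod_cast hN
  unfold blockWt
  rw [div_le_iff₀ (pow_pos hN0 D)]
  calc ∏ i, gNormSq N (kfine N p m i) ≤ ∏ i, ((N : ℝ) ^ 2 * sinWt N (kfine N p m i)) :=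
        Finset.prod_le_prod (fun i _ => gNormSq_nonneg _ _) fun i _ => gNormSq_le_sq_mul_sinWt N _
    _ = (N : ℝ) ^ D * (∏ i, sinWt N (kfine N p m i)) * (N : ℝ) ^ D := by
        rw [Finset.prod_mul_distrib, Finset.prod_const, Finset.card_univ, Fintype.card_fin]
        ring

/-- [folklore] `w_m ≤ N^D` (all the `sinWt` are `≤ 1`). -/
theorem blockWt_le_pow {N : ℕ} (hN : 1 ≤ N) (p : Fin D → ℝ) (m : Fin D → ZMod N) :
    blockWt N p m ≤ (N : ℝ) ^ D := by
  refine (blockWt_le hN p m).trans (mul_le_of_le_one_right (pow_nonneg (Nat.cast_nonneg N) D) ?_)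
  exact Finset.prod_le_one (fun i _ => (sinWt_pos _ _).le) fun i _ => sinWt_le_one _ _

/-- [folklore] The fine momentum of the ZERO alias is `p/N`. -/
theorem kfine_zero (N : ℕ) (p : Fin D → ℝ) (i : Fin D) : kfine N p 0 i = p i / N := by
  simp [kfine]

/-- **ZERO-ALIAS WEIGHT LOWER BOUND** [folklore]: `(4/π²)^D · N^D ≤ w_0` on `[−π, π]^D`, every `N ≥ 1`. -/
theorem pow_le_blockWt_zero {N : ℕ} (hN : 1 ≤ N) {p : Fin D → ℝ} (hp : ∀ i, |p i| ≤ π) :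
    (4 / π ^ 2) ^ D * (N : ℝ) ^ D ≤ blockWt N p 0 := by
  have hN0 : (0 : ℝ) < N := by exact_mod_cast hN
  unfold blockWt
  rw [le_div_iff₀ (pow_pos hN0 D)]
  calc (4 / π ^ 2) ^ D * (N : ℝ) ^ D * (N : ℝ) ^ D = ∏ _i : Fin D, (4 / π ^ 2 * (N : ℝ) ^ 2) := by
        rw [Finset.prod_const, Finset.card_univ, Fintype.card_fin, mul_pow]; ring
    _ ≤ ∏ i, gNormSq N (kfine N p 0 i) :=
        Finset.prod_le_prod (fun i _ => by positivity) fun i _ => by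
          rw [kfine_zero]; exact sq_le_gNormSq_zero hN (hp i)

/-- [folklore] `N²·L_0 = Σ_i N²·4 sin²(p_i/(2N))` — the scaled Laplacian symbol at the zero alias. -/
theorem sq_mul_lapR_zero (N : ℕ) (p : Fin D → ℝ) :
    (N : ℝ) ^ 2 * lapR (kfine N p 0) = ∑ i, (N : ℝ) ^ 2 * (4 * Real.sin (p i / (2 * N)) ^ 2) := by
  unfold lapR
  rw [Finset.mul_sum]
  refine Finset.sum_congr rfl fun i _ => ?_
  rw [kfine_zero, show p i / N / 2 = p i / (2 * N) by ring]

/-- [folklore] UPPER symbol bound at the zero alias: `N²·L_0 ≤ |p|²` (leaf P1-L07 by name). -/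
theorem sq_mul_lapR_zero_le {N : ℕ} (hN : 1 ≤ N) (p : Fin D → ℝ) : (N : ℝ) ^ 2 * lapR (kfine N p 0) ≤ momSq p := by
  rw [sq_mul_lapR_zero]
  exact SymbolTaylor.sum_sq_mul_four_sin_sq_le_momSq (by exact_mod_cast (by omega : N ≠ 0)) p

/-- [folklore] LOWER (Jordan) symbol bound at the zero alias: `(4/π²)|p|² ≤ N²·L_0` on `[−π, π]^D` (leaf P1-L07 by name). -/
theorem le_sq_mul_lapR_zero {N : ℕ} (hN : 1 ≤ N) {p : Fin D → ℝ} (hp : ∀ i, |p i| ≤ π) :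
    4 / π ^ 2 * momSq p ≤ (N : ℝ) ^ 2 * lapR (kfine N p 0) := by
  have hN0 : (0 : ℝ) < N := by exact_mod_cast hN
  rw [sq_mul_lapR_zero]
  refine (SymbolTaylor.two_sided_sq_mul_lapSym hN0 fun κ => ?_).1
  have h1 : (1 : ℝ) ≤ N := by exact_mod_cast hN
  calc |p κ| ≤ π := hp κ
    _ = π * 1 := (mul_one π).symm
    _ ≤ π * N := mul_le_mul_of_nonneg_left h1 Real.pi_pos.le

/-- [folklore] `p ≠ 0 ⇒ |p|² > 0`. -/
theorem momSq_pos {p : Fin D → ℝ} (hp0 : p ≠ 0) : 0 < momSq p := by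
  obtain ⟨i, hi⟩ : ∃ i, p i ≠ 0 := by
    by_contra h
    exact hp0 (funext fun i => by simpa using (not_exists.1 h) i)
  unfold momSq
  exact lt_of_lt_of_le (by positivity : 0 < p i ^ 2)
    (Finset.single_le_sum (f := fun j => p j ^ 2) (fun j _ => sq_nonneg _) (Finset.mem_univ i))

/-- [folklore] At a nonzero Brillouin momentum the zero-alias symbol is positive: `0 < L_0`. -/
theorem lapR_zero_pos {N : ℕ} (hN : 1 ≤ N) {p : Fin D → ℝ} (hp : ∀ i, |p i| ≤ π) (hp0 : p ≠ 0) :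
    0 < lapR (kfine N p 0) := by
  have hN0 : (0 : ℝ) < N := by exact_mod_cast hN
  have h := le_sq_mul_lapR_zero hN hp
  have hm := momSq_pos hp0
  have : 0 < (N : ℝ) ^ 2 * lapR (kfine N p 0) := lt_of_lt_of_le (by positivity) h
  exact pos_of_mul_pos_right this (sq_nonneg _)

/-- [folklore] A NONZERO alias has positive symbol: `0 < L_m` (`4 ≤ N²L_m`, leaf P1-L06 by name). -/
theorem lapR_pos_of_ne_zero {N : ℕ} [NeZero N] {p : Fin D → ℝ} (hp : ∀ i, |p i| ≤ π) {m : Fin D → ZMod N}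
    (hm : m ≠ 0) : 0 < lapR (kfine N p m) := by
  have h := four_le_sq_mul_lapR hp hm
  have : 0 < (N : ℝ) ^ 2 * lapR (kfine N p m) := by linarith
  exact pos_of_mul_pos_right this (sq_nonneg _)

/-! ## §3  The diagonal scalars `a_κ(p)` -/

/-- The DIAGONAL capacitance scalar `a_κ(p) = Σ_{m ∈ (ℤ/N)^D} w_m·|s_κ(m)|²/(2L_m)` (`= Σ_m wQ_{mκ}wE_{mκ}/(2L_m)` at real `p`). -/
def capDiag (N : ℕ) [NeZero N] (p : Fin D → ℝ) (κ : Fin D) : ℝ :=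
  ∑ m : Fin D → ZMod N, blockWt N p m * gNormSq N (kfine N p m κ) / (2 * lapR (kfine N p m))

/-- [folklore] Every summand of `a_κ` is `≥ 0`. -/
theorem capDiag_term_nonneg (N : ℕ) [NeZero N] (p : Fin D → ℝ) (κ : Fin D) (m : Fin D → ZMod N) :
    0 ≤ blockWt N p m * gNormSq N (kfine N p m κ) / (2 * lapR (kfine N p m)) :=
  div_nonneg (mul_nonneg (blockWt_nonneg _ _ _) (gNormSq_nonneg _ _)) (mul_nonneg zero_le_two (lapR_nonneg _))

/-- [folklore] THE ZERO-ALIAS TERM FROM BELOW: `(4/π²)^{D+1}·N^{D+4}/(2|p|²) ≤ w_0|s_κ(0)|²/(2L_0)`. -/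
theorem capDiag_zero_term_ge {N : ℕ} [NeZero N] (hN : 1 ≤ N) {p : Fin D → ℝ} (hp : ∀ i, |p i| ≤ π) (hp0 : p ≠ 0)
    (κ : Fin D) :
    (4 / π ^ 2) ^ (D + 1) * (N : ℝ) ^ (D + 4) / (2 * momSq p)
      ≤ blockWt N p 0 * gNormSq N (kfine N p 0 κ) / (2 * lapR (kfine N p 0)) := by
  have hN0 : (0 : ℝ) < N := by exact_mod_cast hN
  have hL0 := lapR_zero_pos hN hp hp0
  have hw := pow_le_blockWt_zero hN hp
  have hg : 4 / π ^ 2 * (N : ℝ) ^ 2 ≤ gNormSq N (kfine N p 0 κ) := by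
    rw [kfine_zero]; exact sq_le_gNormSq_zero hN (hp κ)
  have hm := momSq_pos hp0
  have hπ0 : (0 : ℝ) < π := Real.pi_pos
  have hLup' : lapR (kfine N p 0) ≤ momSq p / (N : ℝ) ^ 2 := by
    have := sq_mul_lapR_zero_le hN p
    rw [le_div_iff₀ (by positivity)]
    linarith
  have hLup : 2 * lapR (kfine N p 0) ≤ 2 * (momSq p / (N : ℝ) ^ 2) := by linarith
  have hAB : 0 ≤ (4 / π ^ 2) ^ D * (N : ℝ) ^ D * (4 / π ^ 2 * (N : ℝ) ^ 2) := by positivity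
  calc (4 / π ^ 2) ^ (D + 1) * (N : ℝ) ^ (D + 4) / (2 * momSq p)
      = (4 / π ^ 2) ^ D * (N : ℝ) ^ D * (4 / π ^ 2 * (N : ℝ) ^ 2) / (2 * (momSq p / (N : ℝ) ^ 2)) := by
        rw [pow_succ, pow_add]
        field_simp
    _ ≤ (4 / π ^ 2) ^ D * (N : ℝ) ^ D * (4 / π ^ 2 * (N : ℝ) ^ 2) / (2 * lapR (kfine N p 0)) :=
        div_le_div_of_nonneg_left hAB (by positivity) hLup
    _ ≤ blockWt N p 0 * gNormSq N (kfine N p 0 κ) / (2 * lapR (kfine N p 0)) :=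
        div_le_div_of_nonneg_right (mul_le_mul hw hg (by positivity) (blockWt_nonneg _ _ _)) (by positivity)

/-- **LOWER BOUND FOR `a_κ` (node N09/N10, zero alias alone).**  For `N ≥ 1`, `p ∈ [−π, π]^D`, `p ≠ 0`:
`(4/π²)^{D+1} · N^{D+4}/(2|p|²) ≤ a_κ(p)`. [folklore; King 1986 Lemma 4.1 pattern] -/
theorem capDiag_ge {N : ℕ} [NeZero N] (hN : 1 ≤ N) {p : Fin D → ℝ} (hp : ∀ i, |p i| ≤ π) (hp0 : p ≠ 0) (κ : Fin D) :
    (4 / π ^ 2) ^ (D + 1) * (N : ℝ) ^ (D + 4) / (2 * momSq p) ≤ capDiag N p κ := by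
  unfold capDiag
  exact (capDiag_zero_term_ge hN hp hp0 κ).trans
    (Finset.single_le_sum (f := fun m => blockWt N p m * gNormSq N (kfine N p m κ) / (2 * lapR (kfine N p m)))
      (fun m _ => capDiag_term_nonneg N p κ m) (Finset.mem_univ _))

/-- [folklore] THE ZERO-ALIAS TERM FROM ABOVE: `w_0|s_κ(0)|²/(2L_0) ≤ π²·N^{D+4}/(8|p|²)`. -/
theorem capDiag_zero_term_le {N : ℕ} [NeZero N] (hN : 1 ≤ N) {p : Fin D → ℝ} (hp : ∀ i, |p i| ≤ π) (hp0 : p ≠ 0)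
    (κ : Fin D) :
    blockWt N p 0 * gNormSq N (kfine N p 0 κ) / (2 * lapR (kfine N p 0)) ≤ π ^ 2 * (N : ℝ) ^ (D + 4) / (8 * momSq p) := by
  have hN0 : (0 : ℝ) < N := by exact_mod_cast hN
  have hm := momSq_pos hp0
  have hπ0 : (0 : ℝ) < π := Real.pi_pos
  have hLlow' : 4 / π ^ 2 * momSq p / (N : ℝ) ^ 2 ≤ lapR (kfine N p 0) := by
    have := le_sq_mul_lapR_zero hN hp
    rw [div_le_iff₀ (by positivity)]
    linarith
  have hLlow : 2 * (4 / π ^ 2 * momSq p / (N : ℝ) ^ 2) ≤ 2 * lapR (kfine N p 0) := by linarith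
  have hnum : blockWt N p 0 * gNormSq N (kfine N p 0 κ) ≤ (N : ℝ) ^ D * (N : ℝ) ^ 2 :=
    mul_le_mul (blockWt_le_pow hN p 0) (gNormSq_le_sq N _) (gNormSq_nonneg _ _) (by positivity)
  calc blockWt N p 0 * gNormSq N (kfine N p 0 κ) / (2 * lapR (kfine N p 0))
      ≤ (N : ℝ) ^ D * (N : ℝ) ^ 2 / (2 * lapR (kfine N p 0)) :=
        div_le_div_of_nonneg_right hnum (mul_nonneg zero_le_two (lapR_nonneg _))
    _ ≤ (N : ℝ) ^ D * (N : ℝ) ^ 2 / (2 * (4 / π ^ 2 * momSq p / (N : ℝ) ^ 2)) :=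
        div_le_div_of_nonneg_left (by positivity) (by positivity) hLlow
    _ = π ^ 2 * (N : ℝ) ^ (D + 4) / (8 * momSq p) := by
        rw [pow_add]
        field_simp
        ring

/-- [folklore] A NONZERO-ALIAS TERM FROM ABOVE: `w_m|s_κ(m)|²/(2L_m) ≤ (N^{D+4}/2)·aliasWtTerm N p m` (`m ≠ 0`). -/
theorem capDiag_term_le {N : ℕ} [NeZero N] (hN : 1 ≤ N) {p : Fin D → ℝ} (hp : ∀ i, |p i| ≤ π) (κ : Fin D)
    {m : Fin D → ZMod N} (hm : m ≠ 0) :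
    blockWt N p m * gNormSq N (kfine N p m κ) / (2 * lapR (kfine N p m))
      ≤ (N : ℝ) ^ (D + 4) / 2 * aliasWtTerm N p m := by
  have hN0 : (0 : ℝ) < N := by exact_mod_cast hN
  have hL := lapR_pos_of_ne_zero hp hm
  have hP0 : 0 ≤ ∏ i, sinWt N (kfine N p m i) := Finset.prod_nonneg fun i _ => (sinWt_pos _ _).le
  have hnum : blockWt N p m * gNormSq N (kfine N p m κ) ≤ ((N : ℝ) ^ D * ∏ i, sinWt N (kfine N p m i)) * (N : ℝ) ^ 2 :=
    mul_le_mul (blockWt_le hN p m) (gNormSq_le_sq N _) (gNormSq_nonneg _ _) (by positivity)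
  calc blockWt N p m * gNormSq N (kfine N p m κ) / (2 * lapR (kfine N p m))
      ≤ ((N : ℝ) ^ D * ∏ i, sinWt N (kfine N p m i)) * (N : ℝ) ^ 2 / (2 * lapR (kfine N p m)) :=
        div_le_div_of_nonneg_right hnum (by positivity)
    _ = (N : ℝ) ^ (D + 4) / 2 * aliasWtTerm N p m := by
        unfold aliasWtTerm
        field_simp
        ring

/-- **UPPER BOUND FOR `a_κ` (node N10).**  For `N ≥ 1`, `p ∈ [−π, π]^D`, `p ≠ 0`:
`a_κ(p) ≤ N^{D+4} · (π²/(8|p|²) + aliasWtConst D/2)` (zero alias by Jordan + the others by leaf P1-L06 `alias_sum_le`). [folklore] -/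
theorem capDiag_le {N : ℕ} [NeZero N] (hN : 1 ≤ N) {p : Fin D → ℝ} (hp : ∀ i, |p i| ≤ π) (hp0 : p ≠ 0) (κ : Fin D) :
    capDiag N p κ ≤ (N : ℝ) ^ (D + 4) * (π ^ 2 / (8 * momSq p) + aliasWtConst D / 2) := by
  classical
  have hN0 : (0 : ℝ) < N := by exact_mod_cast hN
  unfold capDiag
  rw [← Finset.add_sum_erase _ _ (Finset.mem_univ (0 : Fin D → ZMod N))]
  have h0 := capDiag_zero_term_le hN hp hp0 κ
  have hrest : ∑ m ∈ (Finset.univ : Finset (Fin D → ZMod N)).erase 0,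
        blockWt N p m * gNormSq N (kfine N p m κ) / (2 * lapR (kfine N p m))
      ≤ (N : ℝ) ^ (D + 4) / 2 * aliasWtConst D := by
    calc ∑ m ∈ (Finset.univ : Finset (Fin D → ZMod N)).erase 0,
          blockWt N p m * gNormSq N (kfine N p m κ) / (2 * lapR (kfine N p m))
        ≤ ∑ m ∈ (Finset.univ : Finset (Fin D → ZMod N)).erase 0, (N : ℝ) ^ (D + 4) / 2 * aliasWtTerm N p m :=
          Finset.sum_le_sum fun m hm => capDiag_term_le hN hp κ (Finset.ne_of_mem_erase hm)
      _ = (N : ℝ) ^ (D + 4) / 2 * ∑ m ∈ (Finset.univ : Finset (Fin D → ZMod N)).erase 0, aliasWtTerm N p m := by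
          rw [Finset.mul_sum]
      _ ≤ (N : ℝ) ^ (D + 4) / 2 * aliasWtConst D :=
          mul_le_mul_of_nonneg_left (alias_sum_le N hp) (by positivity)
  calc blockWt N p 0 * gNormSq N (kfine N p 0 κ) / (2 * lapR (kfine N p 0))
        + ∑ m ∈ (Finset.univ : Finset (Fin D → ZMod N)).erase 0,
            blockWt N p m * gNormSq N (kfine N p m κ) / (2 * lapR (kfine N p m))
      ≤ π ^ 2 * (N : ℝ) ^ (D + 4) / (8 * momSq p) + (N : ℝ) ^ (D + 4) / 2 * aliasWtConst D := add_le_add h0 hrest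
    _ = (N : ℝ) ^ (D + 4) * (π ^ 2 / (8 * momSq p) + aliasWtConst D / 2) := by ring

/-- [folklore] `0 < a_κ(p)` on the punctured zone, every `N ≥ 1`. -/
theorem capDiag_pos {N : ℕ} [NeZero N] (hN : 1 ≤ N) {p : Fin D → ℝ} (hp : ∀ i, |p i| ≤ π) (hp0 : p ≠ 0) (κ : Fin D) :
    0 < capDiag N p κ := by
  have hN0 : (0 : ℝ) < N := by exact_mod_cast hN
  have hm := momSq_pos hp0
  exact lt_of_lt_of_le (by positivity) (capDiag_ge hN hp hp0 κ)

/-- [folklore] INVERSE FORM (the hypothesis `‖a_κ⁻¹‖ ≤ α` of `CapacitanceClosedForm` §6):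
`a_κ(p)⁻¹ ≤ 2|p|²/((4/π²)^{D+1} N^{D+4})`. -/
theorem inv_capDiag_le {N : ℕ} [NeZero N] (hN : 1 ≤ N) {p : Fin D → ℝ} (hp : ∀ i, |p i| ≤ π) (hp0 : p ≠ 0)
    (κ : Fin D) : (capDiag N p κ)⁻¹ ≤ 2 * momSq p / ((4 / π ^ 2) ^ (D + 1) * (N : ℝ) ^ (D + 4)) := by
  have hN0 : (0 : ℝ) < N := by exact_mod_cast hN
  have hm := momSq_pos hp0
  have h := capDiag_ge hN hp hp0 κ
  have hlow : 0 < (4 / π ^ 2) ^ (D + 1) * (N : ℝ) ^ (D + 4) / (2 * momSq p) := by positivity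
  calc (capDiag N p κ)⁻¹ ≤ ((4 / π ^ 2) ^ (D + 1) * (N : ℝ) ^ (D + 4) / (2 * momSq p))⁻¹ :=
        inv_anti₀ hlow h
    _ = 2 * momSq p / ((4 / π ^ 2) ^ (D + 1) * (N : ℝ) ^ (D + 4)) := by rw [inv_div]

end Summit.QuantumFields.BalabanUV.Beta.GAN24.CapacitanceScalarBounds

end
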